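import Summits.CriticalPhenomena.PercolationContinuityZ3.Theorems.PercNearOneGluingNoHeavyLowerTailApexForestBridgeEvents
import HarnessLib

/-!
# Kozma–Nitzan Conjectures 1–2 on APEX-FOREST graphs — semantic bridge, part 3: the event identities for `{o ↮ A ∪ c}` and `{α ↮ c}`
# (`NoHeavyLowerTail` cell, stmt-CriticalPhenomena-4575; new-inequality factory seat `prim-ineq-gen-7`, gen 3)

Support file (`--supports stmt-CriticalPhenomena-4575`).  Deterministic lemmas; no measure theory, no definitions, no named facts, no sorries.
Completes the deterministic layer (FACTS 1–3 + bridge split) of the plan run/shared/lean/prim/prim-ineq-gen-7/LEAN-PLAN-APEXFOREST.md: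

* `ApexForestBridge.not_openConn_hub_relays_iff` — **(E2)**: `o ↮ c ∧ o ↮ A` iff every vertex joined to `o` inside its side has a closed hub pair and is not a
  relay, and, if the bridge pair `e` is open, the same for `v₁` inside its side (`{o ↮ A∪c} = HC∩RF(S_o) ∩ ({e closed} ∪ HC∩RF(S₁))`);
* `ApexForestBridge.not_openConn_hub_iff_of_side` — **(E3)**: for a vertex `α` of the `v₁`-side, `α ↮ c` iff every vertex joined to `α` inside that side has a
  closed hub pair and, if `e` is open and `α ↔ v₁` inside the side, every vertex joined to `o` inside the `o`-side has a closed hub pair — the set identity behind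
  `P(α ↮ c) = d_α − q(1−a)e_α` in PROOF-CONJ1/CONJ2-APEXFOREST.md.
What remains for the kernel theorems `ApexForest.conj1/conj2`: null pairs, `DeterminedBy` of the side events + product-measure independence, the induction bookkeeping.
[cite: Grimmett1999, §1.3 (open paths and clusters)]
-/

namespace Summit.CriticalPhenomena.PercolationContinuityZ3.Theorems

namespace ApexForestBridge

open Literature.Probability.Percolation ApexForestWalks

variable {V : Type*} [DecidableEq V]

/-! ### Part 3: the event identities (E2) `{o ↮ A ∪ c}` and (E3) `{α ↮ c}` for a relay on the far side -/

/-- **Event identity (E2): `{o ↮ A ∪ {c}}` across the bridge.**  `o` is joined neither to `c` nor to any relay iff: every vertex joined to `o` inside its side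
has a closed hub pair and is not a relay, and, if `e` is open, the same for `v₁` inside its side. [folklore] -/
theorem not_openConn_hub_relays_iff {ω : BondConfig V} {D : Set (Sym2 V)} {c o v₁ : V} (A : Finset V)
    (hDc : ∀ p ∈ D, c ∉ p) (hov : o ≠ v₁) (he : s(o, v₁) ∈ D)
    (hbridge : ¬ (SimpleGraph.fromEdgeSet (D \ {s(o, v₁)})).Reachable o v₁)
    (hω : ∀ p ∈ ω, p ∈ D ∨ c ∈ p) :
    (ω ∉ (openConn o c : Set (BondConfig V)) ∧ ∀ a ∈ A, ω ∉ (openConn o a : Set (BondConfig V))) ↔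
      ((∀ u, ω ∈ openConnIn {x | (SimpleGraph.fromEdgeSet (D \ {s(o, v₁)})).Reachable o x} o u → s(u, c) ∉ ω ∧ u ∉ A) ∧
        (s(o, v₁) ∈ ω → ∀ u, ω ∈ openConnIn {x | (SimpleGraph.fromEdgeSet (D \ {s(o, v₁)})).Reachable v₁ x} v₁ u → s(u, c) ∉ ω ∧ u ∉ A)) := by
  have hE1 := not_openConn_hub_iff hDc hov he hbridge hω
  constructor
  · rintro ⟨hnc, hnA⟩
    obtain ⟨h1, h2⟩ := hE1.1 hnc
    have hreach : ∀ a ∈ A, ω ∉ openConnIn ({c}ᶜ : Set V) o a := fun a ha h =>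
      hnA a ha ((openConn_iff_openConnIn_compl_of_not_hub hnc).2 h)
    refine ⟨fun u hu => ⟨h1 u hu, fun huA => hreach u huA ?_⟩, fun heω u hu => ⟨h2 heω u hu, fun huA => hreach u huA ?_⟩⟩
    · exact (openConnIn_compl_hub_iff hDc hov he hbridge hω u).2 (Or.inl hu)
    · exact (openConnIn_compl_hub_iff hDc hov he hbridge hω u).2 (Or.inr ⟨heω, hu⟩)
  · rintro ⟨h1, h2⟩
    have hnc : ω ∉ (openConn o c : Set (BondConfig V)) :=
      hE1.2 ⟨fun u hu => (h1 u hu).1, fun heω u hu => (h2 heω u hu).1⟩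
    refine ⟨hnc, fun a ha hoa => ?_⟩
    have h' := (openConn_iff_openConnIn_compl_of_not_hub hnc).1 hoa
    rcases (openConnIn_compl_hub_iff hDc hov he hbridge hω a).1 h' with hu | ⟨heω, hu⟩
    · exact (h1 a hu).2 ha
    · exact (h2 heω a hu).2 ha

/-- **Event identity (E3): `{α ↮ c}` for a vertex `α` on the `v₁`-side.**  `α ↮ c` iff every vertex joined to `α` inside the `v₁`-side has a closed hub pair,
and, if `e` is open and `α` is joined to `v₁` inside that side, also every vertex joined to `o` inside the `o`-side has a closed hub pair. [folklore] -/
theorem not_openConn_hub_iff_of_side {ω : BondConfig V} {D : Set (Sym2 V)} {c o v₁ α : V}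
    (hDc : ∀ p ∈ D, c ∉ p) (hov : o ≠ v₁) (he : s(o, v₁) ∈ D)
    (hbridge : ¬ (SimpleGraph.fromEdgeSet (D \ {s(o, v₁)})).Reachable o v₁)
    (hα : (SimpleGraph.fromEdgeSet (D \ {s(o, v₁)})).Reachable v₁ α)
    (hω : ∀ p ∈ ω, p ∈ D ∨ c ∈ p) :
    ω ∉ (openConn α c : Set (BondConfig V)) ↔
      ((∀ u, ω ∈ openConnIn {x | (SimpleGraph.fromEdgeSet (D \ {s(o, v₁)})).Reachable v₁ x} α u → s(u, c) ∉ ω) ∧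
        (s(o, v₁) ∈ ω → ω ∈ openConnIn {x | (SimpleGraph.fromEdgeSet (D \ {s(o, v₁)})).Reachable v₁ x} α v₁ →
          ∀ u, ω ∈ openConnIn {x | (SimpleGraph.fromEdgeSet (D \ {s(o, v₁)})).Reachable o x} o u → s(u, c) ∉ ω)) := by
  have hoc : o ≠ c := fun h => hDc _ he (h ▸ Sym2.mem_mk_left o v₁)
  have hv₁c : v₁ ≠ c := fun h => hDc _ he (h ▸ Sym2.mem_mk_right o v₁)
  have hcF' : ∀ a b, (SimpleGraph.fromEdgeSet (D \ {s(o, v₁)})).Reachable a b → a ≠ c → b ≠ c := by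
    intro a b hab hac hbc
    subst hbc
    rw [SimpleGraph.reachable_iff_reflTransGen] at hab
    rcases Relation.ReflTransGen.cases_tail hab with h' | ⟨z, _, hzc⟩
    · exact hac h'.symm
    · exact hDc _ ((SimpleGraph.fromEdgeSet_adj _).1 hzc).1.1 (Sym2.mem_mk_right z b)
  have hαc : α ≠ c := hcF' v₁ α hα hv₁c
  -- the bridge with endpoints swapped: `e = s(v₁, o)`
  have he' : s(v₁, o) ∈ D := by rw [Sym2.eq_swap]; exact he
  have hbridge' : ¬ (SimpleGraph.fromEdgeSet (D \ {s(v₁, o)})).Reachable v₁ o := by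
    rw [Sym2.eq_swap]; exact fun h => hbridge h.symm
  have hα' : (SimpleGraph.fromEdgeSet (D \ {s(v₁, o)})).Reachable v₁ α := by rw [Sym2.eq_swap]; exact hα
  have hside := fun u => openConnIn_compl_hub_iff_of_side (ω := ω) hDc hov.symm he' hbridge' hα' hω u
  simp only [Sym2.eq_swap (a := v₁) (b := o)] at hside
  have hne1 : ∀ u, ω ∈ openConnIn {x | (SimpleGraph.fromEdgeSet (D \ {s(o, v₁)})).Reachable v₁ x} α u → u ≠ c :=
    fun u hu => hcF' v₁ u (DCT16.pathIn_of_mem_openConnIn hu).right_mem hv₁c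
  have hneo : ∀ u, ω ∈ openConnIn {x | (SimpleGraph.fromEdgeSet (D \ {s(o, v₁)})).Reachable o x} o u → u ≠ c :=
    fun u hu => hcF' o u (DCT16.pathIn_of_mem_openConnIn hu).right_mem hoc
  rw [openConn_hub_iff ω hαc]
  constructor
  · intro h
    refine ⟨fun u hu hsc => h ⟨u, hne1 u hu, (hside u).2 (Or.inl hu), hsc⟩, fun heω hαv u hu hsc => h ⟨u, hneo u hu, ?_, hsc⟩⟩
    exact (hside u).2 (Or.inr ⟨heω, hαv, hu⟩)
  · rintro ⟨h1, h2⟩ ⟨u, _, hu, hsc⟩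
    rcases (hside u).1 hu with hu' | ⟨heω, hαv, hu'⟩
    · exact h1 u hu' hsc
    · exact h2 heω hαv u hu' hsc

end ApexForestBridge

end Summit.CriticalPhenomena.PercolationContinuityZ3.Theorems
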